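import Mathlib
import Literature.NumberTheory.LFunctions.CharacterHarmonicTails
import HarnessLib

/-!
# Zhang (2022) §12: Abel summation with complex bounded-variation weights and Pólya–Vinogradov
# windows (the far `m`-range of the thin-window `S_j` estimates hS / hS′)

Topic `Literature/NumberTheory/LFunctions/Zhang2022` (Landau–Siegel audit tree; verdict-neutral).
Y. Zhang, *Discrete mean estimates and the Landau–Siegel zero*, arXiv:2211.02515v1 (2022)
[Zhang2022LandauSiegel] — **an unrefereed manuscript under adjudication; nothing here asserts or
denies its Theorems 1–2.** ZHANG-L lane, WP12, leaf hXi / binder h128 (RT-06): helper file for the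
dual-window `S_j`-estimate hS′ of `Typed.Sec12A.eq128_of_sj_small` (row G-d42-3 (ii)) and its (12.6)
twin hS (row G-d42-2).

In `S_j(𝐚₁,𝐚₂) = Σ_{d,r} |μ(r)|λ₀ⱼ(dr)/(drφ(r))·(Σ_m 𝐚₁(drm)m^{β_j−1})·(Σ_n 𝐚₂(drn)ξ₀ⱼ(n;d,r)/n)`
(`Skeleton.Sj`, §7 Prop. 7.1) with a window sequence `𝐚₁(n) = χ̄(n)·ρ(n)` supported on a
multiplicatively thin window `n ∈ (Xη₋, Xη₊)`, the inner `m`-sum is a character sum over a window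
`m ∈ (A, B]`, `A ≍ Y = X/(dr)`, against the complex weight `φ(m) = ρ(drm)·m^{β_j−1}` of bounded
variation. In the far range (`Y` large) the Pólya–Vinogradov inequality and Abel summation give
`‖Σ_m‖ ≤ √D(1+log D)·(sup‖φ‖ + TV φ) ≪ √D log D/Y`, better than the trivial `(B−A)/A`.
This file supplies that step as THEOREMS ONLY (no definitions):

* §A `sum_Ioc_mul_eq_abel`, `sum_Ioc_mul_eq_abel_last`, `norm_sum_Ioc_mul_le_tv`,
  `norm_sum_Ioc_mul_le_of_sup_tv` — Abel summation / bounds for `Σ_{N<n≤M} u(n)φ(n)` with COMPLEX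
  weights `φ` and any `u` whose window partial sums are `≤ W`:
  `‖Σ‖ ≤ W·(‖φ(M)‖ + Σ_{N<n<M} ‖φ(n) − φ(n+1)‖)`;
* §B `norm_sum_Ioc_chi_mul_le_tv`, `norm_sum_Ioc_conj_chi_mul_le_tv` (+ `_of_sup_tv` forms) — the
  same with `u = χ` or `u = χ̄`, `χ` primitive mod `D ≥ 2`, `W = √D(1 + log D)`
  (tree `CharacterTails.norm_window_le_polyaVinogradov`);
* §C total-variation calculus for `Σ_{n∈s} ‖f(n) − f(n+1)‖`: sum/difference/scalar/conjugate/
  product rules, restriction to a sub-window, real monotone sequences (telescoping), one-jump step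
  functions, `m ↦ g(X/m)` for monotone `g`, and `m ↦ m^w`, `m ↦ (xm)^w`
  (`‖t₁^w − t₂^w‖ ≤ ‖w‖a^{Re w−1}|t₁ − t₂|` on `[a,b]`); support transfer `Σ_S = Σ_{(A,B]}` and the
  identification of a real window `y₁ < m < y₂` with `(⌊y₁⌋, ⌈y₂⌉−1]`;
* §D the packaged far-range bounds: `norm_window_sum_le_far` — for `ρ` with `‖ρ‖ ≤ S` and TV
  `≤ V` on the window, `1 ≤ A ≤ B` and `Re s = 1`,
  `‖Σ_{A<m≤B} χ̄(m)ρ(m)/m^{s}‖ ≤ √D(1+log D)·(S·(1 + ‖s‖(B−A)/A) + V)/A` (also with `χ` in place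
  of `χ̄`); `norm_window_sum_mul_le_far` — the product form `ρ = P·Q` (`‖P‖ ≤ 1`, TV `P ≤ T`,
  `‖Q‖ ≤ κ`, TV `Q ≤ V`): `≤ √D(1+log D)·(κ(1 + ‖s‖(B−A)/A + T) + V)/A`; and the model instance
  `norm_window_sum_profile_le_far` for `P(m) = (xm/X₁)^θ` (`Re θ = 0`),
  `Q(m) = κ(g(X₂/(xm)) − 𝟙[xm < X₂])` with `g` monotone `[0,1]`-valued:
  `≤ √D(1+log D)·|κ|·(3 + (‖s‖ + ‖θ‖)(B−A)/A)/A`.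

## References

* Y. Zhang, arXiv:2211.02515v1 (2022), §7 Prop. 7.1 (the sums `S_j`), §12 (12.6)–(12.8) p. 67.
  [cite: Zhang2022LandauSiegel, §12 (12.6)–(12.8) p. 67]
* H. L. Montgomery, R. C. Vaughan, *Multiplicative Number Theory I*, CUP 2007, §1.3 Thm. 1.3
  (Abel summation), §9.4 Thm. 9.18 (Pólya–Vinogradov). [cite: MontgomeryVaughan2007, §1.3, §9.4]
-/

noncomputable section

open Finset Complex ComplexConjugate

namespace Literature.NumberTheory.LFunctions.Zhang2022.WindowAbelBV

/-! ### §A. Abel summation with bounded partial sums and complex weights -/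

/-- **Abel summation over a window** (finite form of MV Thm. 1.3), complex weights:
for `N ≤ M`, `Σ_{N<n≤M} u(n)φ(n) = U(M)φ(M+1) + Σ_{N<n≤M} U(n)(φ(n) − φ(n+1))`,
`U(n) = Σ_{N<k≤n} u(k)`. [cite: MontgomeryVaughan2007, §1.3 Thm. 1.3] -/
theorem sum_Ioc_mul_eq_abel (u φ : ℕ → ℂ) {N M : ℕ} (h : N ≤ M) :
    ∑ n ∈ Ioc N M, u n * φ n =
      (∑ n ∈ Ioc N M, u n) * φ (M + 1) +
        ∑ n ∈ Ioc N M, (∑ k ∈ Ioc N n, u k) * (φ n - φ (n + 1)) := by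
  induction M, h using Nat.le_induction with
  | base => simp
  | succ M hNM ih =>
    rw [Finset.sum_Ioc_succ_top hNM, ih, Finset.sum_Ioc_succ_top hNM,
      Finset.sum_Ioc_succ_top hNM, Finset.sum_Ioc_succ_top hNM]
    ring

/-- **Abel summation, last-value form**: for `N ≤ M`,
`Σ_{N<n≤M} u(n)φ(n) = U(M)φ(M) + Σ_{N<n<M} U(n)(φ(n) − φ(n+1))` (only values of `φ` inside the
window `(N, M]` occur). [cite: MontgomeryVaughan2007, §1.3 Thm. 1.3] -/
theorem sum_Ioc_mul_eq_abel_last (u φ : ℕ → ℂ) {N M : ℕ} (h : N ≤ M) :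
    ∑ n ∈ Ioc N M, u n * φ n =
      (∑ n ∈ Ioc N M, u n) * φ M +
        ∑ n ∈ Ioo N M, (∑ k ∈ Ioc N n, u k) * (φ n - φ (n + 1)) := by
  rcases Nat.eq_or_lt_of_le h with rfl | hlt
  · simp
  · obtain ⟨K, rfl⟩ : ∃ K, M = K + 1 := ⟨M - 1, by omega⟩
    have hNK : N ≤ K := by omega
    have hIoo : Finset.Ioo N (K + 1) = Finset.Ioc N K := by
      ext n; simp only [Finset.mem_Ioo, Finset.mem_Ioc]; omega
    rw [Finset.sum_Ioc_succ_top hNK, sum_Ioc_mul_eq_abel u φ hNK, hIoo,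
      Finset.sum_Ioc_succ_top hNK]
    ring

/-- **The Abel bound with a window bound `W` and complex weights**: if `‖Σ_{N<k≤n} u(k)‖ ≤ W` for
`N < n ≤ M` (and `W ≥ 0`), then
`‖Σ_{N<n≤M} u(n)φ(n)‖ ≤ W·(‖φ(M)‖ + Σ_{N<n<M} ‖φ(n) − φ(n+1)‖)`.
[cite: MontgomeryVaughan2007, §1.3 Thm. 1.3] -/
theorem norm_sum_Ioc_mul_le_tv {u φ : ℕ → ℂ} {N M : ℕ} {W : ℝ} (hW : 0 ≤ W)
    (hU : ∀ n ∈ Ioc N M, ‖∑ k ∈ Ioc N n, u k‖ ≤ W) :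
    ‖∑ n ∈ Ioc N M, u n * φ n‖ ≤
      W * (‖φ M‖ + ∑ n ∈ Ioo N M, ‖φ n - φ (n + 1)‖) := by
  rcases le_or_gt M N with h | hlt
  · rw [Finset.Ioc_eq_empty (by omega), Finset.sum_empty, norm_zero]
    positivity
  have hM : M ∈ Ioc N M := Finset.mem_Ioc.mpr ⟨hlt, le_rfl⟩
  rw [sum_Ioc_mul_eq_abel_last u φ hlt.le]
  calc ‖(∑ n ∈ Ioc N M, u n) * φ M +
        ∑ n ∈ Ioo N M, (∑ k ∈ Ioc N n, u k) * (φ n - φ (n + 1))‖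
      ≤ ‖(∑ n ∈ Ioc N M, u n) * φ M‖ +
        ∑ n ∈ Ioo N M, ‖(∑ k ∈ Ioc N n, u k) * (φ n - φ (n + 1))‖ :=
          (norm_add_le _ _).trans (by gcongr; exact norm_sum_le _ _)
    _ ≤ W * ‖φ M‖ + ∑ n ∈ Ioo N M, W * ‖φ n - φ (n + 1)‖ := by
        gcongr with n hn
        · rw [norm_mul]
          exact mul_le_mul_of_nonneg_right (hU M hM) (norm_nonneg _)
        · rw [norm_mul]
          have hn' : n ∈ Ioc N M := by
            rw [Finset.mem_Ioo] at hn; rw [Finset.mem_Ioc]; omega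
          exact mul_le_mul_of_nonneg_right (hU n hn') (norm_nonneg _)
    _ = W * (‖φ M‖ + ∑ n ∈ Ioo N M, ‖φ n - φ (n + 1)‖) := by
        rw [← Finset.mul_sum]; ring

/-- **The Abel bound, sup + total-variation form**: under the window bound `W ≥ 0`, a sup bound
`‖φ(n)‖ ≤ S` (`S ≥ 0`) on `(N, M]` and a total-variation bound `Σ_{N<n<M} ‖φ(n) − φ(n+1)‖ ≤ V`:
`‖Σ_{N<n≤M} u(n)φ(n)‖ ≤ W·(S + V)`. [cite: MontgomeryVaughan2007, §1.3 Thm. 1.3] -/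
theorem norm_sum_Ioc_mul_le_of_sup_tv {u φ : ℕ → ℂ} {N M : ℕ} {W S V : ℝ} (hW : 0 ≤ W)
    (hU : ∀ n ∈ Ioc N M, ‖∑ k ∈ Ioc N n, u k‖ ≤ W) (hS : 0 ≤ S)
    (hφ : ∀ n ∈ Ioc N M, ‖φ n‖ ≤ S) (hV : ∑ n ∈ Ioo N M, ‖φ n - φ (n + 1)‖ ≤ V) :
    ‖∑ n ∈ Ioc N M, u n * φ n‖ ≤ W * (S + V) := by
  rcases le_or_gt M N with h | hlt
  · rw [Finset.Ioc_eq_empty (by omega), Finset.sum_empty, norm_zero]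
    rw [Finset.Ioo_eq_empty (by omega), Finset.sum_empty] at hV
    exact mul_nonneg hW (add_nonneg hS hV)
  · refine (norm_sum_Ioc_mul_le_tv hW hU).trans (mul_le_mul_of_nonneg_left ?_ hW)
    exact add_le_add (hφ M (Finset.mem_Ioc.mpr ⟨hlt, le_rfl⟩)) hV

/-- A window-partial-sum bound for ALL `n` restricts to the window `(N, M]`.
[cite: MontgomeryVaughan2007, §1.3 Thm. 1.3] -/
theorem window_bound_of_forall {u : ℕ → ℂ} {N : ℕ} (M : ℕ) {W : ℝ}
    (hU : ∀ n, ‖∑ k ∈ Ioc N n, u k‖ ≤ W) : ∀ n ∈ Ioc N M, ‖∑ k ∈ Ioc N n, u k‖ ≤ W :=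
  fun n _ => hU n

/-! ### §B. Pólya–Vinogradov windows against complex bounded-variation weights -/

section Character

variable {D : ℕ} (χ : DirichletCharacter ℂ D)

/-- `0 ≤ √D(1 + log D)`. [cite: Zhang2022LandauSiegel, §12 (12.6)–(12.8) p. 67] -/
theorem pvConst_nonneg (D : ℕ) : 0 ≤ Real.sqrt D * (1 + Real.log D) := by
  have : 0 ≤ Real.log (D : ℝ) := Real.log_natCast_nonneg D
  positivity

/-- **Pólya–Vinogradov + Abel, complex weights**: for `χ` primitive mod `D ≥ 2`, any `φ : ℕ → ℂ`
and any window `(N, M]`,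
`‖Σ_{N<n≤M} χ(n)φ(n)‖ ≤ √D(1+log D)·(‖φ(M)‖ + Σ_{N<n<M} ‖φ(n) − φ(n+1)‖)`.
[cite: MontgomeryVaughan2007, §9.4 Thm. 9.18 with §1.3 Thm. 1.3] -/
theorem norm_sum_Ioc_chi_mul_le_tv (hχ : χ.IsPrimitive) (hD : 2 ≤ D) (φ : ℕ → ℂ) (N M : ℕ) :
    ‖∑ n ∈ Ioc N M, χ (n : ZMod D) * φ n‖ ≤
      Real.sqrt D * (1 + Real.log D) * (‖φ M‖ + ∑ n ∈ Ioo N M, ‖φ n - φ (n + 1)‖) :=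
  norm_sum_Ioc_mul_le_tv (u := fun n => χ (n : ZMod D)) (pvConst_nonneg D)
    (fun n _ => CharacterTails.norm_window_le_polyaVinogradov χ hχ hD N n)

/-- **Pólya–Vinogradov + Abel with `χ̄`**: the same bound for `Σ_{N<n≤M} conj χ(n)·φ(n)`
(conjugate the whole sum). [cite: MontgomeryVaughan2007, §9.4 Thm. 9.18 with §1.3 Thm. 1.3] -/
theorem norm_sum_Ioc_conj_chi_mul_le_tv (hχ : χ.IsPrimitive) (hD : 2 ≤ D) (φ : ℕ → ℂ)
    (N M : ℕ) :
    ‖∑ n ∈ Ioc N M, conj (χ (n : ZMod D)) * φ n‖ ≤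
      Real.sqrt D * (1 + Real.log D) * (‖φ M‖ + ∑ n ∈ Ioo N M, ‖φ n - φ (n + 1)‖) := by
  have key := norm_sum_Ioc_chi_mul_le_tv χ hχ hD (fun n => conj (φ n)) N M
  have h1 : ∑ n ∈ Ioc N M, conj (χ (n : ZMod D)) * φ n =
      conj (∑ n ∈ Ioc N M, χ (n : ZMod D) * conj (φ n)) := by
    rw [map_sum]
    refine Finset.sum_congr rfl fun n _ => ?_
    rw [map_mul, Complex.conj_conj]
  rw [h1, Complex.norm_conj]
  simpa only [← map_sub, Complex.norm_conj] using key

/-- **Pólya–Vinogradov + Abel, sup + total-variation form** (`χ`): with `‖φ‖ ≤ S` (`S ≥ 0`) on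
`(N, M]` and TV `≤ V` there, `‖Σ_{N<n≤M} χ(n)φ(n)‖ ≤ √D(1+log D)·(S + V)`.
[cite: MontgomeryVaughan2007, §9.4 Thm. 9.18 with §1.3 Thm. 1.3] -/
theorem norm_sum_Ioc_chi_mul_le_of_sup_tv (hχ : χ.IsPrimitive) (hD : 2 ≤ D) {φ : ℕ → ℂ}
    {N M : ℕ} {S V : ℝ} (hS : 0 ≤ S) (hφ : ∀ n ∈ Ioc N M, ‖φ n‖ ≤ S)
    (hV : ∑ n ∈ Ioo N M, ‖φ n - φ (n + 1)‖ ≤ V) :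
    ‖∑ n ∈ Ioc N M, χ (n : ZMod D) * φ n‖ ≤ Real.sqrt D * (1 + Real.log D) * (S + V) :=
  norm_sum_Ioc_mul_le_of_sup_tv (u := fun n => χ (n : ZMod D)) (pvConst_nonneg D)
    (fun n _ => CharacterTails.norm_window_le_polyaVinogradov χ hχ hD N n) hS hφ hV

/-- **Pólya–Vinogradov + Abel, sup + total-variation form** (`χ̄`).
[cite: MontgomeryVaughan2007, §9.4 Thm. 9.18 with §1.3 Thm. 1.3] -/
theorem norm_sum_Ioc_conj_chi_mul_le_of_sup_tv (hχ : χ.IsPrimitive) (hD : 2 ≤ D) {φ : ℕ → ℂ}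
    {N M : ℕ} {S V : ℝ} (hS : 0 ≤ S) (hφ : ∀ n ∈ Ioc N M, ‖φ n‖ ≤ S)
    (hV : ∑ n ∈ Ioo N M, ‖φ n - φ (n + 1)‖ ≤ V) :
    ‖∑ n ∈ Ioc N M, conj (χ (n : ZMod D)) * φ n‖ ≤
      Real.sqrt D * (1 + Real.log D) * (S + V) := by
  rcases le_or_gt M N with h | hlt
  · rw [Finset.Ioc_eq_empty (by omega), Finset.sum_empty, norm_zero]
    rw [Finset.Ioo_eq_empty (by omega), Finset.sum_empty] at hV
    exact mul_nonneg (pvConst_nonneg D) (add_nonneg hS hV)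
  · refine (norm_sum_Ioc_conj_chi_mul_le_tv χ hχ hD φ N M).trans
      (mul_le_mul_of_nonneg_left ?_ (pvConst_nonneg D))
    exact add_le_add (hφ M (Finset.mem_Ioc.mpr ⟨hlt, le_rfl⟩)) hV

end Character

/-! ### §C. Total-variation calculus on `ℕ`-windows -/

/-- TV of a sum: `TV(f + g) ≤ TV f + TV g`. [cite: MontgomeryVaughan2007, §1.3 Thm. 1.3] -/
theorem tv_add_le (f g : ℕ → ℂ) (s : Finset ℕ) :
    ∑ n ∈ s, ‖(f n + g n) - (f (n + 1) + g (n + 1))‖ ≤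
      ∑ n ∈ s, ‖f n - f (n + 1)‖ + ∑ n ∈ s, ‖g n - g (n + 1)‖ := by
  rw [← Finset.sum_add_distrib]
  refine Finset.sum_le_sum fun n _ => ?_
  calc ‖(f n + g n) - (f (n + 1) + g (n + 1))‖ = ‖(f n - f (n + 1)) + (g n - g (n + 1))‖ := by
        ring_nf
    _ ≤ ‖f n - f (n + 1)‖ + ‖g n - g (n + 1)‖ := norm_add_le _ _

/-- TV of a difference: `TV(f − g) ≤ TV f + TV g`. [cite: MontgomeryVaughan2007, §1.3 Thm. 1.3] -/
theorem tv_sub_le (f g : ℕ → ℂ) (s : Finset ℕ) :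
    ∑ n ∈ s, ‖(f n - g n) - (f (n + 1) - g (n + 1))‖ ≤
      ∑ n ∈ s, ‖f n - f (n + 1)‖ + ∑ n ∈ s, ‖g n - g (n + 1)‖ := by
  rw [← Finset.sum_add_distrib]
  refine Finset.sum_le_sum fun n _ => ?_
  calc ‖(f n - g n) - (f (n + 1) - g (n + 1))‖ = ‖(f n - f (n + 1)) - (g n - g (n + 1))‖ := by
        ring_nf
    _ ≤ ‖f n - f (n + 1)‖ + ‖g n - g (n + 1)‖ := norm_sub_le _ _

/-- TV of a scalar multiple: `TV(c·f) = ‖c‖·TV f`. [cite: MontgomeryVaughan2007, §1.3 Thm. 1.3] -/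
theorem tv_const_mul (c : ℂ) (f : ℕ → ℂ) (s : Finset ℕ) :
    ∑ n ∈ s, ‖c * f n - c * f (n + 1)‖ = ‖c‖ * ∑ n ∈ s, ‖f n - f (n + 1)‖ := by
  rw [Finset.mul_sum]
  refine Finset.sum_congr rfl fun n _ => ?_
  rw [← mul_sub, norm_mul]

/-- TV is invariant under complex conjugation. [cite: MontgomeryVaughan2007, §1.3 Thm. 1.3] -/
theorem tv_conj (f : ℕ → ℂ) (s : Finset ℕ) :
    ∑ n ∈ s, ‖conj (f n) - conj (f (n + 1))‖ = ∑ n ∈ s, ‖f n - f (n + 1)‖ := by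
  refine Finset.sum_congr rfl fun n _ => ?_
  rw [← map_sub, Complex.norm_conj]

/-- TV of a real sequence viewed in `ℂ`. [cite: MontgomeryVaughan2007, §1.3 Thm. 1.3] -/
theorem tv_ofReal (g : ℕ → ℝ) (s : Finset ℕ) :
    ∑ n ∈ s, ‖(g n : ℂ) - (g (n + 1) : ℂ)‖ = ∑ n ∈ s, |g n - g (n + 1)| := by
  refine Finset.sum_congr rfl fun n _ => ?_
  rw [← Complex.ofReal_sub, Complex.norm_real, Real.norm_eq_abs]

/-- TV is monotone in the index set. [cite: MontgomeryVaughan2007, §1.3 Thm. 1.3] -/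
theorem tv_mono {s t : Finset ℕ} (h : s ⊆ t) (f : ℕ → ℂ) :
    ∑ n ∈ s, ‖f n - f (n + 1)‖ ≤ ∑ n ∈ t, ‖f n - f (n + 1)‖ :=
  Finset.sum_le_sum_of_subset_of_nonneg h fun _ _ _ => norm_nonneg _

/-- **Product rule**: with `‖f‖ ≤ F` on `s` and `‖g(·+1)‖ ≤ G` on `s`,
`TV(fg) ≤ F·TV g + G·TV f`. [cite: MontgomeryVaughan2007, §1.3 Thm. 1.3] -/
theorem tv_mul_le {f g : ℕ → ℂ} {s : Finset ℕ} {F G : ℝ}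
    (hF : ∀ n ∈ s, ‖f n‖ ≤ F) (hG : ∀ n ∈ s, ‖g (n + 1)‖ ≤ G) :
    ∑ n ∈ s, ‖f n * g n - f (n + 1) * g (n + 1)‖ ≤
      F * ∑ n ∈ s, ‖g n - g (n + 1)‖ + G * ∑ n ∈ s, ‖f n - f (n + 1)‖ := by
  rw [Finset.mul_sum, Finset.mul_sum, ← Finset.sum_add_distrib]
  refine Finset.sum_le_sum fun n hn => ?_
  have h : f n * g n - f (n + 1) * g (n + 1) =
      f n * (g n - g (n + 1)) + (f n - f (n + 1)) * g (n + 1) := by ring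
  rw [h]
  calc ‖f n * (g n - g (n + 1)) + (f n - f (n + 1)) * g (n + 1)‖
      ≤ ‖f n * (g n - g (n + 1))‖ + ‖(f n - f (n + 1)) * g (n + 1)‖ := norm_add_le _ _
    _ = ‖f n‖ * ‖g n - g (n + 1)‖ + ‖g (n + 1)‖ * ‖f n - f (n + 1)‖ := by
        rw [norm_mul, norm_mul]; ring
    _ ≤ F * ‖g n - g (n + 1)‖ + G * ‖f n - f (n + 1)‖ := by
        gcongr
        · exact hF n hn
        · exact hG n hn

/-- **Telescoping, antitone real sequence**: if `g(n+1) ≤ g(n)` for `a ≤ n < b` then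
`Σ_{a≤n<b} |g(n) − g(n+1)| = g(a) − g(b)`. [cite: MontgomeryVaughan2007, §1.3 Thm. 1.3] -/
theorem tv_real_antitone {g : ℕ → ℝ} {a b : ℕ} (hab : a ≤ b)
    (hg : ∀ n, a ≤ n → n < b → g (n + 1) ≤ g n) :
    ∑ n ∈ Ico a b, |g n - g (n + 1)| = g a - g b := by
  induction b, hab using Nat.le_induction with
  | base => simp
  | succ b hab ih =>
    rw [Finset.sum_Ico_succ_top hab, ih (fun n h1 h2 => hg n h1 (by omega)),
      abs_of_nonneg (sub_nonneg.mpr (hg b hab (by omega)))]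
    ring

/-- **Telescoping, monotone real sequence**: if `g(n) ≤ g(n+1)` for `a ≤ n < b` then
`Σ_{a≤n<b} |g(n) − g(n+1)| = g(b) − g(a)`. [cite: MontgomeryVaughan2007, §1.3 Thm. 1.3] -/
theorem tv_real_monotone {g : ℕ → ℝ} {a b : ℕ} (hab : a ≤ b)
    (hg : ∀ n, a ≤ n → n < b → g n ≤ g (n + 1)) :
    ∑ n ∈ Ico a b, |g n - g (n + 1)| = g b - g a := by
  induction b, hab using Nat.le_induction with
  | base => simp
  | succ b hab ih =>
    rw [Finset.sum_Ico_succ_top hab, ih (fun n h1 h2 => hg n h1 (by omega)),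
      abs_of_nonpos (sub_nonpos.mpr (hg b hab (by omega)))]
    ring

/-- An antitone real sequence with values in `[lo, hi]` on `[a, b]` has TV `≤ hi − lo` there.
[cite: MontgomeryVaughan2007, §1.3 Thm. 1.3] -/
theorem tv_real_antitone_le {g : ℕ → ℝ} {a b : ℕ} {lo hi : ℝ} (hab : a ≤ b)
    (hg : ∀ n, a ≤ n → n < b → g (n + 1) ≤ g n) (ha : g a ≤ hi) (hb : lo ≤ g b) :
    ∑ n ∈ Ico a b, |g n - g (n + 1)| ≤ hi - lo := by
  rw [tv_real_antitone hab hg]; linarith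

/-- A monotone real sequence with values in `[lo, hi]` on `[a, b]` has TV `≤ hi − lo` there.
[cite: MontgomeryVaughan2007, §1.3 Thm. 1.3] -/
theorem tv_real_monotone_le {g : ℕ → ℝ} {a b : ℕ} {lo hi : ℝ} (hab : a ≤ b)
    (hg : ∀ n, a ≤ n → n < b → g n ≤ g (n + 1)) (ha : lo ≤ g a) (hb : g b ≤ hi) :
    ∑ n ∈ Ico a b, |g n - g (n + 1)| ≤ hi - lo := by
  rw [tv_real_monotone hab hg]; linarith

/-- **`m ↦ g(X/m)` is antitone** for `g` monotone, `X ≥ 0`, `m ≥ 1`.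
[cite: MontgomeryVaughan2007, §1.3 Thm. 1.3] -/
theorem comp_div_antitone {g : ℝ → ℝ} (hg : Monotone g) {X : ℝ} (hX : 0 ≤ X) {n : ℕ}
    (hn : 1 ≤ n) : g (X / (n + 1 : ℕ)) ≤ g (X / n) := by
  refine hg (div_le_div_of_nonneg_left hX (by exact_mod_cast (by omega : 0 < n)) ?_)
  push_cast; linarith

/-- **TV of `m ↦ g(X/(xm))`** for `g` monotone with values in `[lo, hi]`, `X ≥ 0`, `x > 0`, on a
window `[a, b]` with `a ≥ 1`: `≤ hi − lo`. [cite: MontgomeryVaughan2007, §1.3 Thm. 1.3] -/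
theorem tv_comp_div_le {g : ℝ → ℝ} (hg : Monotone g) {lo hi : ℝ} (hlo : ∀ y, lo ≤ g y)
    (hhi : ∀ y, g y ≤ hi) {X x : ℝ} (hX : 0 ≤ X) (hx : 0 < x) {a b : ℕ} (ha : 1 ≤ a)
    (hab : a ≤ b) :
    ∑ n ∈ Ico a b, |g (X / (x * n)) - g (X / (x * (n + 1 : ℕ)))| ≤ hi - lo := by
  refine tv_real_antitone_le (g := fun n : ℕ => g (X / (x * n))) hab ?_ (hhi _) (hlo _)
  intro n h1 _
  have hn0 : (0 : ℝ) < n := by exact_mod_cast (by omega : 0 < n)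
  refine hg (div_le_div_of_nonneg_left hX (mul_pos hx hn0) ?_)
  push_cast; nlinarith

/-- **One-jump step functions**: if the predicate `p` is downward closed (`p m → p n` for `n ≤ m`),
the step sequence `n ↦ if p n then c₁ else c₂` has TV `≤ ‖c₁ − c₂‖` on any index set.
[cite: MontgomeryVaughan2007, §1.3 Thm. 1.3] -/
theorem tv_step_le {p : ℕ → Prop} {_hdec : DecidablePred p} (hp : ∀ m n, n ≤ m → p m → p n)
    (c₁ c₂ : ℂ) (s : Finset ℕ) :
    ∑ n ∈ s, ‖(if p n then c₁ else c₂) - (if p (n + 1) then c₁ else c₂)‖ ≤ ‖c₁ - c₂‖ := by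
  have hterm : ∀ n, ‖(if p n then c₁ else c₂) - (if p (n + 1) then c₁ else c₂)‖ =
      if p n ∧ ¬ p (n + 1) then ‖c₁ - c₂‖ else 0 := by
    intro n
    by_cases h1 : p n
    · by_cases h2 : p (n + 1)
      · simp [h1, h2]
      · simp [h1, h2]
    · have h2 : ¬ p (n + 1) := fun h => h1 (hp (n + 1) n (by omega) h)
      simp [h1, h2]
  simp_rw [hterm]
  rw [Finset.sum_ite, Finset.sum_const_zero, add_zero, Finset.sum_const, nsmul_eq_mul]
  have hcard : ((s.filter (fun n => p n ∧ ¬ p (n + 1))).card : ℝ) ≤ 1 := by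
    exact_mod_cast Finset.card_le_one.mpr (fun a ha b hb => by
      rw [Finset.mem_filter] at ha hb
      by_contra hab
      rcases lt_or_gt_of_ne hab with h | h
      · exact ha.2.2 (hp b (a + 1) (by omega) hb.2.1)
      · exact hb.2.2 (hp a (b + 1) (by omega) ha.2.1))
  calc ((s.filter (fun n => p n ∧ ¬ p (n + 1))).card : ℝ) * ‖c₁ - c₂‖ ≤ 1 * ‖c₁ - c₂‖ := by
        gcongr
    _ = ‖c₁ - c₂‖ := one_mul _

/-- **One-jump real step functions** (real values `c₁, c₂`).
[cite: MontgomeryVaughan2007, §1.3 Thm. 1.3] -/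
theorem tv_step_real_le {p : ℕ → Prop} {_hdec : DecidablePred p}
    (hp : ∀ m n, n ≤ m → p m → p n) (c₁ c₂ : ℝ) (s : Finset ℕ) :
    ∑ n ∈ s, |(if p n then c₁ else c₂) - (if p (n + 1) then c₁ else c₂)| ≤ |c₁ - c₂| := by
  have key := tv_step_le (_hdec := _hdec) hp (c₁ : ℂ) (c₂ : ℂ) s
  have h1 : ∀ n, ((if p n then (c₁ : ℂ) else (c₂ : ℂ)) : ℂ) = ((if p n then c₁ else c₂ : ℝ) : ℂ) :=
    fun n => by split_ifs <;> rfl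
  simp_rw [h1] at key
  rw [tv_ofReal] at key
  rwa [← Complex.ofReal_sub, Complex.norm_real, Real.norm_eq_abs] at key

/-- The threshold predicate `m ↦ x·m < X` (`x ≥ 0`) is downward closed.
[cite: MontgomeryVaughan2007, §1.3 Thm. 1.3] -/
theorem downward_mul_lt {x : ℝ} (hx : 0 ≤ x) (X : ℝ) :
    ∀ m n : ℕ, n ≤ m → x * m < X → x * n < X := by
  intro m n hnm h
  have : x * (n : ℝ) ≤ x * m := mul_le_mul_of_nonneg_left (by exact_mod_cast hnm) hx
  linarith

/-! #### Powers `m ↦ m^w` along a window -/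

/-- **Mean value bound for `t^w` on `[a, b]`**, `a > 0`, `Re w ≤ 1`:
`‖t₁^w − t₂^w‖ ≤ ‖w‖·a^{Re w − 1}·|t₁ − t₂|`.
[cite: Zhang2022LandauSiegel, §12 (12.6)–(12.8) p. 67] -/
theorem norm_cpow_sub_cpow_le {a b : ℝ} (ha : 0 < a) {w : ℂ} (hw : w.re ≤ 1) {t₁ t₂ : ℝ}
    (h₁ : t₁ ∈ Set.Icc a b) (h₂ : t₂ ∈ Set.Icc a b) :
    ‖(t₁ : ℂ) ^ w - (t₂ : ℂ) ^ w‖ ≤ ‖w‖ * a ^ (w.re - 1) * |t₁ - t₂| := by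
  have key := Convex.norm_image_sub_le_of_norm_hasDerivWithin_le
    (f := fun v : ℝ => (v : ℂ) ^ w) (f' := fun v : ℝ => w * (v : ℂ) ^ (w - 1)) (s := Set.Icc a b)
    (C := ‖w‖ * a ^ (w.re - 1)) (x := t₂) (y := t₁) ?_ ?_ (convex_Icc a b) h₂ h₁
  · simpa [Real.norm_eq_abs] using key
  · intro x hx
    -- derivative of `v ↦ v^w` along the positive real axis (tree:
    -- `Literature.NumberTheory.LFunctions.AFE.hasDerivAt_ofReal_cpow`, re-derived to keep imports light)
    exact ((Complex.hasStrictDerivAt_cpow_const (c := w)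
      (Complex.ofReal_mem_slitPlane.2 (ha.trans_le hx.1))).hasDerivAt.comp_ofReal).hasDerivWithinAt
  · intro x hx
    rw [norm_mul]
    refine mul_le_mul_of_nonneg_left ?_ (norm_nonneg _)
    rw [Complex.norm_cpow_eq_rpow_re_of_pos (ha.trans_le hx.1)]
    simp only [Complex.sub_re, Complex.one_re]
    exact Real.rpow_le_rpow_of_nonpos ha hx.1 (by linarith)

/-- `‖m^w‖ = m^{Re w}` for `m ≥ 1` (Mathlib's `Complex.norm_natCast_cpow_of_pos`), packaged as an
upper bound on a window: `‖m^w‖ ≤ a^{Re w}` for `m ≥ a ≥ 1`, `Re w ≤ 0`.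
[cite: Zhang2022LandauSiegel, §12 (12.6)–(12.8) p. 67] -/
theorem norm_natCast_cpow_le {a m : ℕ} (ha : 1 ≤ a) (ham : a ≤ m) {w : ℂ} (hw : w.re ≤ 0) :
    ‖(m : ℂ) ^ w‖ ≤ (a : ℝ) ^ w.re := by
  rw [Complex.norm_natCast_cpow_of_pos (by omega)]
  exact Real.rpow_le_rpow_of_nonpos (by exact_mod_cast ha) (by exact_mod_cast ham) hw

/-- **TV of `m ↦ m^w` on `[a, b]`**, `a ≥ 1`, `Re w ≤ 1`:
`Σ_{a≤n<b} ‖n^w − (n+1)^w‖ ≤ ‖w‖·(b − a)·a^{Re w − 1}`.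
[cite: Zhang2022LandauSiegel, §12 (12.6)–(12.8) p. 67] -/
theorem tv_natCast_cpow_le {a b : ℕ} (ha : 1 ≤ a) (hab : a ≤ b) {w : ℂ} (hw : w.re ≤ 1) :
    ∑ n ∈ Ico a b, ‖(n : ℂ) ^ w - ((n + 1 : ℕ) : ℂ) ^ w‖ ≤
      ‖w‖ * ((b : ℝ) - a) * (a : ℝ) ^ (w.re - 1) := by
  have ha0 : (0 : ℝ) < a := by exact_mod_cast ha
  have hterm : ∀ n ∈ Ico a b,
      ‖(n : ℂ) ^ w - ((n + 1 : ℕ) : ℂ) ^ w‖ ≤ ‖w‖ * (a : ℝ) ^ (w.re - 1) := by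
    intro n hn
    rw [Finset.mem_Ico] at hn
    have key := norm_cpow_sub_cpow_le ha0 hw (b := b) (t₁ := (n : ℝ)) (t₂ := ((n + 1 : ℕ) : ℝ))
      ⟨by exact_mod_cast hn.1, by exact_mod_cast hn.2.le⟩
      ⟨by exact_mod_cast (by omega : a ≤ n + 1), by exact_mod_cast hn.2⟩
    have h1 : ((n : ℝ) : ℂ) = (n : ℂ) := by norm_cast
    have h2 : (((n + 1 : ℕ) : ℝ) : ℂ) = ((n + 1 : ℕ) : ℂ) := by norm_cast
    rw [h1, h2] at key
    refine key.trans (le_of_eq ?_)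
    have : |(n : ℝ) - ((n + 1 : ℕ) : ℝ)| = 1 := by
      push_cast
      rw [show (n : ℝ) - (n + 1) = -1 by ring, abs_neg, abs_one]
    rw [this, mul_one]
  calc ∑ n ∈ Ico a b, ‖(n : ℂ) ^ w - ((n + 1 : ℕ) : ℂ) ^ w‖
      ≤ ∑ n ∈ Ico a b, ‖w‖ * (a : ℝ) ^ (w.re - 1) := Finset.sum_le_sum hterm
    _ = ‖w‖ * ((b : ℝ) - a) * (a : ℝ) ^ (w.re - 1) := by
        rw [Finset.sum_const, Nat.card_Ico, nsmul_eq_mul, Nat.cast_sub hab]; ring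

/-- `(x·m)^w = x^w·m^w` for real `x ≥ 0` and natural `m`.
[cite: Zhang2022LandauSiegel, §12 (12.6)–(12.8) p. 67] -/
theorem ofReal_mul_natCast_cpow {x : ℝ} (hx : 0 ≤ x) (m : ℕ) (w : ℂ) :
    (((x * m : ℝ)) : ℂ) ^ w = (x : ℂ) ^ w * (m : ℂ) ^ w := by
  have := Complex.mul_cpow_ofReal_nonneg hx (Nat.cast_nonneg m) w
  push_cast at this ⊢
  exact this

/-- `conj (y^β) = y^{conj β}` for real `y ≥ 0`.
[cite: Zhang2022LandauSiegel, §12 (12.6)–(12.8) p. 67] -/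
theorem conj_ofReal_cpow {y : ℝ} (hy : 0 ≤ y) (β : ℂ) :
    conj ((y : ℂ) ^ β) = (y : ℂ) ^ (conj β) := by
  have harg : (y : ℂ).arg ≠ Real.pi := by
    rw [Complex.arg_ofReal_of_nonneg hy]; exact Real.pi_pos.ne
  rw [Complex.cpow_conj _ _ harg, Complex.conj_ofReal]

/-- **TV of `m ↦ (x·m)^w` on `[a, b]`**, `x > 0`, `a ≥ 1`, `Re w ≤ 1`:
`≤ x^{Re w}·‖w‖·(b − a)·a^{Re w − 1}`. [cite: Zhang2022LandauSiegel, §12 (12.6)–(12.8) p. 67] -/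
theorem tv_ofReal_mul_natCast_cpow_le {x : ℝ} (hx : 0 < x) {a b : ℕ} (ha : 1 ≤ a) (hab : a ≤ b)
    {w : ℂ} (hw : w.re ≤ 1) :
    ∑ n ∈ Ico a b, ‖(((x * n : ℝ)) : ℂ) ^ w - (((x * (n + 1 : ℕ) : ℝ)) : ℂ) ^ w‖ ≤
      x ^ w.re * (‖w‖ * ((b : ℝ) - a) * (a : ℝ) ^ (w.re - 1)) := by
  simp_rw [ofReal_mul_natCast_cpow hx.le]
  rw [tv_const_mul, Complex.norm_cpow_eq_rpow_re_of_pos hx]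
  exact mul_le_mul_of_nonneg_left (tv_natCast_cpow_le ha hab hw) (Real.rpow_nonneg hx.le _)

/-! #### Support transfer and real windows -/

/-- A sum over `S ⊇ (A, B]` of a function vanishing on `S ∖ (A, B]` is the window sum.
[cite: Zhang2022LandauSiegel, §12 (12.6)–(12.8) p. 67] -/
theorem sum_eq_sum_Ioc_of_support {M : Type*} [AddCommMonoid M] {S : Finset ℕ} {A B : ℕ}
    (hsub : Ioc A B ⊆ S) {f : ℕ → M} (hf : ∀ m ∈ S, m ∉ Ioc A B → f m = 0) :
    ∑ m ∈ S, f m = ∑ m ∈ Ioc A B, f m :=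
  (Finset.sum_subset hsub hf).symm

/-- **A real window is an `Ioc`**: for `y₁ ≥ 0`, `y₁ < m ∧ m < y₂ ↔ m ∈ (⌊y₁⌋, ⌈y₂⌉ − 1]`.
[cite: Zhang2022LandauSiegel, §12 (12.6)–(12.8) p. 67] -/
theorem window_mem_Ioc_iff {y₁ y₂ : ℝ} (hy₁ : 0 ≤ y₁) (m : ℕ) :
    m ∈ Ioc ⌊y₁⌋₊ (⌈y₂⌉₊ - 1) ↔ y₁ < m ∧ (m : ℝ) < y₂ := by
  rw [Finset.mem_Ioc, Nat.floor_lt hy₁]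
  constructor
  · rintro ⟨h1, h2⟩
    refine ⟨h1, ?_⟩
    have hm : 1 ≤ m := by
      have : (0 : ℝ) < m := hy₁.trans_lt h1
      exact_mod_cast this
    have : m < ⌈y₂⌉₊ := by omega
    exact Nat.lt_ceil.mp this
  · rintro ⟨h1, h2⟩
    refine ⟨h1, ?_⟩
    have : m < ⌈y₂⌉₊ := Nat.lt_ceil.mpr h2
    omega

/-- The scaled window: for `x > 0`, `lo < x·m ∧ x·m < hi ↔ lo/x < m ∧ m < hi/x`.
[cite: Zhang2022LandauSiegel, §12 (12.6)–(12.8) p. 67] -/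
theorem mul_window_iff {x lo hi : ℝ} (hx : 0 < x) (m : ℕ) :
    (lo < x * m ∧ x * m < hi) ↔ (lo / x < m ∧ (m : ℝ) < hi / x) := by
  rw [div_lt_iff₀ hx, lt_div_iff₀ hx, mul_comm (m : ℝ) x]

/-! ### §D. The packaged far-range bound -/

section Far

variable {D : ℕ} (χ : DirichletCharacter ℂ D)

/-- `(A, B) = [A+1, B)` as finsets of naturals.
[cite: Zhang2022LandauSiegel, §12 (12.6)–(12.8) p. 67] -/
theorem Ioo_eq_Ico_succ (A B : ℕ) : Finset.Ioo A B = Finset.Ico (A + 1) B := by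
  ext n; simp only [Finset.mem_Ioo, Finset.mem_Ico]; omega

/-- TV and sup of the weight `φ(m) = ρ(m)/m^s` (`Re s = 1`) on `(A, B]`, `A ≥ 1`, from
`‖ρ‖ ≤ S` on `(A, B]` and `TV_{(A,B)} ρ ≤ V`:
sup `≤ S/A` and `TV ≤ S‖s‖(B−A)/A² + V/A`. [cite: Zhang2022LandauSiegel, §12 (12.6)–(12.8) p. 67] -/
theorem weight_div_cpow_bounds {A B : ℕ} (hA : 1 ≤ A) (hAB : A ≤ B) {ρ : ℕ → ℂ} {S V : ℝ}
    (hS : 0 ≤ S) (hρ : ∀ m ∈ Ioc A B, ‖ρ m‖ ≤ S) (hV : ∑ m ∈ Ioo A B, ‖ρ m - ρ (m + 1)‖ ≤ V)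
    {s : ℂ} (hs : s.re = 1) :
    (∀ m ∈ Ioc A B, ‖ρ m / (m : ℂ) ^ s‖ ≤ S / A) ∧
      ∑ m ∈ Ioo A B, ‖ρ m / (m : ℂ) ^ s - ρ (m + 1) / ((m + 1 : ℕ) : ℂ) ^ s‖ ≤
        S * (‖s‖ * ((B : ℝ) - A) / (A : ℝ) ^ 2) + V / A := by
  have hA0 : (0 : ℝ) < A := by exact_mod_cast hA
  -- `‖m^{-s}‖ ≤ 1/A` for `m > A`
  have hinv : ∀ m : ℕ, A < m → ‖((m : ℂ) ^ s)⁻¹‖ ≤ 1 / A := by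
    intro m hm
    rw [norm_inv, Complex.norm_natCast_cpow_of_pos (by omega), hs, Real.rpow_one, one_div]
    exact inv_anti₀ hA0 (by exact_mod_cast hm.le)
  refine ⟨fun m hm => ?_, ?_⟩
  · have hm' := Finset.mem_Ioc.mp hm
    rw [norm_div, Complex.norm_natCast_cpow_of_pos (by omega), hs, Real.rpow_one]
    exact div_le_div₀ hS (hρ m hm) hA0 (by exact_mod_cast hm'.1.le)
  · have hφ : ∀ m : ℕ, ρ m / (m : ℂ) ^ s = ρ m * ((m : ℂ) ^ s)⁻¹ := fun m => div_eq_mul_inv _ _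
    simp_rw [hφ]
    have hprod := tv_mul_le (s := Ioo A B) (f := ρ) (g := fun m : ℕ => ((m : ℂ) ^ s)⁻¹)
      (F := S) (G := 1 / A)
      (fun n hn => hρ n (by rw [Finset.mem_Ioo] at hn; rw [Finset.mem_Ioc]; omega))
      (fun n hn => hinv (n + 1) (by rw [Finset.mem_Ioo] at hn; omega))
    refine hprod.trans ?_
    have htv : ∑ n ∈ Ioo A B, ‖((n : ℂ) ^ s)⁻¹ - (((n + 1 : ℕ) : ℂ) ^ s)⁻¹‖ ≤
        ‖s‖ * ((B : ℝ) - A) / (A : ℝ) ^ 2 := by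
      rcases Nat.eq_or_lt_of_le hAB with rfl | hlt
      · simp
      simp_rw [← Complex.cpow_neg]
      rw [Ioo_eq_Ico_succ]
      have key := tv_natCast_cpow_le (a := A + 1) (b := B) (by omega) (by omega) (w := -s)
        (by rw [Complex.neg_re, hs]; norm_num)
      refine key.trans ?_
      have hre : (-s).re - 1 = -2 := by rw [Complex.neg_re, hs]; norm_num
      rw [norm_neg, hre]
      have hltR : (A : ℝ) < B := by exact_mod_cast hlt
      have h1 : ((A + 1 : ℕ) : ℝ) ^ (-2 : ℝ) ≤ 1 / (A : ℝ) ^ 2 := by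
        rw [Real.rpow_neg (by positivity), one_div]
        refine inv_anti₀ (by positivity) ?_
        rw [show (2 : ℝ) = (2 : ℕ) by norm_num, Real.rpow_natCast]
        gcongr
        linarith
      calc ‖s‖ * ((B : ℝ) - ((A + 1 : ℕ) : ℝ)) * ((A + 1 : ℕ) : ℝ) ^ (-2 : ℝ)
          ≤ ‖s‖ * ((B : ℝ) - A) * (1 / (A : ℝ) ^ 2) := by
            apply mul_le_mul _ h1 (Real.rpow_nonneg (by positivity) _) (by
              apply mul_nonneg (norm_nonneg _); linarith)
            apply mul_le_mul_of_nonneg_left _ (norm_nonneg _)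
            push_cast; linarith
        _ = ‖s‖ * ((B : ℝ) - A) / (A : ℝ) ^ 2 := by ring
    have hV' : (1 / (A : ℝ)) * ∑ n ∈ Ioo A B, ‖ρ n - ρ (n + 1)‖ ≤ V / A := by
      rw [one_div, inv_mul_eq_div]
      exact div_le_div_of_nonneg_right hV hA0.le
    calc S * ∑ n ∈ Ioo A B, ‖((n : ℂ) ^ s)⁻¹ - (((n + 1 : ℕ) : ℂ) ^ s)⁻¹‖ +
          1 / (A : ℝ) * ∑ n ∈ Ioo A B, ‖ρ n - ρ (n + 1)‖
        ≤ S * (‖s‖ * ((B : ℝ) - A) / (A : ℝ) ^ 2) + V / A :=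
          add_le_add (mul_le_mul_of_nonneg_left htv hS) hV'

/-- **The far-range window bound (`χ̄`)**: for `χ` primitive mod `D ≥ 2`, a window `(A, B]` with
`1 ≤ A ≤ B`, a complex weight `ρ` with `‖ρ‖ ≤ S` on `(A, B]` and
`Σ_{A<m<B} ‖ρ(m) − ρ(m+1)‖ ≤ V`, and `Re s = 1`:
`‖Σ_{A<m≤B} χ̄(m)ρ(m)/m^s‖ ≤ √D(1+log D)·(S·(1 + ‖s‖(B−A)/A) + V)/A`.
In the `S_j` bookkeeping (`A ≍ Y = X/(dr)`, `(B−A)/A ≍ 𝓛⁻¹⁰`) this is the `≪ √D log D/Y` bound of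
the far range. [cite: MontgomeryVaughan2007, §9.4 Thm. 9.18 with §1.3 Thm. 1.3] -/
theorem norm_window_sum_le_far (hχ : χ.IsPrimitive) (hD : 2 ≤ D) {A B : ℕ} (hA : 1 ≤ A)
    (hAB : A ≤ B) {ρ : ℕ → ℂ} {S V : ℝ} (hS : 0 ≤ S) (hρ : ∀ m ∈ Ioc A B, ‖ρ m‖ ≤ S)
    (hV : ∑ m ∈ Ioo A B, ‖ρ m - ρ (m + 1)‖ ≤ V) {s : ℂ} (hs : s.re = 1) :
    ‖∑ m ∈ Ioc A B, conj (χ (m : ZMod D)) * (ρ m / (m : ℂ) ^ s)‖ ≤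
      Real.sqrt D * (1 + Real.log D) *
        ((S * (1 + ‖s‖ * ((B : ℝ) - A) / A) + V) / A) := by
  have hA0 : (0 : ℝ) < A := by exact_mod_cast hA
  have hA1 : (A : ℝ) ≠ 0 := hA0.ne'
  obtain ⟨hsup, htv⟩ := weight_div_cpow_bounds hA hAB hS hρ hV hs
  have key := norm_sum_Ioc_conj_chi_mul_le_of_sup_tv χ hχ hD (φ := fun m => ρ m / (m : ℂ) ^ s)
    (div_nonneg hS hA0.le) hsup htv
  refine key.trans (le_of_eq ?_)
  congr 1
  field_simp
  ring

/-- **The far-range window bound (`χ`)**: the same with `χ` in place of `χ̄`.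
[cite: MontgomeryVaughan2007, §9.4 Thm. 9.18 with §1.3 Thm. 1.3] -/
theorem norm_window_sum_le_far' (hχ : χ.IsPrimitive) (hD : 2 ≤ D) {A B : ℕ} (hA : 1 ≤ A)
    (hAB : A ≤ B) {ρ : ℕ → ℂ} {S V : ℝ} (hS : 0 ≤ S) (hρ : ∀ m ∈ Ioc A B, ‖ρ m‖ ≤ S)
    (hV : ∑ m ∈ Ioo A B, ‖ρ m - ρ (m + 1)‖ ≤ V) {s : ℂ} (hs : s.re = 1) :
    ‖∑ m ∈ Ioc A B, χ (m : ZMod D) * (ρ m / (m : ℂ) ^ s)‖ ≤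
      Real.sqrt D * (1 + Real.log D) *
        ((S * (1 + ‖s‖ * ((B : ℝ) - A) / A) + V) / A) := by
  have hA0 : (0 : ℝ) < A := by exact_mod_cast hA
  have hA1 : (A : ℝ) ≠ 0 := hA0.ne'
  obtain ⟨hsup, htv⟩ := weight_div_cpow_bounds hA hAB hS hρ hV hs
  have key := norm_sum_Ioc_chi_mul_le_of_sup_tv χ hχ hD (φ := fun m => ρ m / (m : ℂ) ^ s)
    (div_nonneg hS hA0.le) hsup htv
  refine key.trans (le_of_eq ?_)
  congr 1
  field_simp
  ring

/-- **The far-range bound for a product weight `ρ = P·Q`**: with `‖P‖ ≤ 1`, `‖Q‖ ≤ κ` on `(A, B]`,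
`TV_{(A,B)} P ≤ T`, `TV_{(A,B)} Q ≤ V` and `Re s = 1`,
`‖Σ_{A<m≤B} χ̄(m)P(m)Q(m)/m^s‖ ≤ √D(1+log D)·(κ·(1 + ‖s‖(B−A)/A + T) + V)/A`.
(For the `S_j` window sequences: `P(m) = χ̄(dr)(drm/P″₁)^{β̄₆}` — norm `≤ 1`,
`T = ‖β₆‖(B−A)/A` by `tv_ofReal_mul_natCast_cpow_le` — and `Q(m)` = the real window profile —
`κ = sup`, `V ≤ 2κ` for a monotone bump by `tv_comp_div_le` + `tv_step_le`.)
[cite: MontgomeryVaughan2007, §9.4 Thm. 9.18 with §1.3 Thm. 1.3] -/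
theorem norm_window_sum_mul_le_far (hχ : χ.IsPrimitive) (hD : 2 ≤ D) {A B : ℕ} (hA : 1 ≤ A)
    (hAB : A ≤ B) {P Q : ℕ → ℂ} {κ T V : ℝ} (hκ : 0 ≤ κ)
    (hP : ∀ m ∈ Ioc A B, ‖P m‖ ≤ 1) (hQ : ∀ m ∈ Ioc A B, ‖Q m‖ ≤ κ)
    (hTP : ∑ m ∈ Ioo A B, ‖P m - P (m + 1)‖ ≤ T) (hTQ : ∑ m ∈ Ioo A B, ‖Q m - Q (m + 1)‖ ≤ V)
    {s : ℂ} (hs : s.re = 1) :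
    ‖∑ m ∈ Ioc A B, conj (χ (m : ZMod D)) * (P m * Q m / (m : ℂ) ^ s)‖ ≤
      Real.sqrt D * (1 + Real.log D) *
        ((κ * (1 + ‖s‖ * ((B : ℝ) - A) / A + T) + V) / A) := by
  have hA0 : (0 : ℝ) < A := by exact_mod_cast hA
  have hρ : ∀ m ∈ Ioc A B, ‖P m * Q m‖ ≤ κ := by
    intro m hm
    rw [norm_mul]
    calc ‖P m‖ * ‖Q m‖ ≤ 1 * κ := mul_le_mul (hP m hm) (hQ m hm) (norm_nonneg _) zero_le_one
      _ = κ := one_mul κ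
  have hV : ∑ m ∈ Ioo A B, ‖P m * Q m - P (m + 1) * Q (m + 1)‖ ≤ 1 * V + κ * T := by
    have h := tv_mul_le (s := Ioo A B) (f := P) (g := Q) (F := 1) (G := κ)
      (fun n hn => hP n (by rw [Finset.mem_Ioo] at hn; rw [Finset.mem_Ioc]; omega))
      (fun n hn => hQ (n + 1) (by rw [Finset.mem_Ioo] at hn; rw [Finset.mem_Ioc]; omega))
    refine h.trans (add_le_add ?_ ?_)
    · exact mul_le_mul_of_nonneg_left hTQ zero_le_one
    · exact mul_le_mul_of_nonneg_left hTP hκ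
  have key := norm_window_sum_le_far χ hχ hD hA hAB (ρ := fun m => P m * Q m) hκ hρ hV hs
  refine key.trans (le_of_eq ?_)
  have hA1 : (A : ℝ) ≠ 0 := hA0.ne'
  congr 1
  field_simp
  ring

/-- **The far-range bound for the model window profile.** For `χ` primitive mod `D ≥ 2`, a window
`(A, B]` with `1 ≤ A ≤ B`, reals `x > 0`, `X₁ > 0`, `X₂ ≥ 0`, `κ`, a monotone `g : ℝ → ℝ` with
values in `[0, 1]` (e.g. the Gaussian step `g` of (4.1)), exponents `θ` with `Re θ = 0` and `s`
with `Re s = 1`: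
`‖Σ_{A<m≤B} χ̄(m)·(xm/X₁)^θ·κ(g(X₂/(xm)) − 𝟙[xm < X₂])/m^s‖
  ≤ √D(1+log D)·|κ|·(3 + (‖s‖ + ‖θ‖)(B−A)/A)/A`
(`P(m) = (xm/X₁)^θ`: norm `1`, TV `≤ ‖θ‖(B−A)/A`; `Q = κ(g − 𝟙)`: `|Q| ≤ |κ|`, TV `≤ 2|κ|`).
[cite: Zhang2022LandauSiegel, §12 (12.6)–(12.8) p. 67] -/
theorem norm_window_sum_profile_le_far (hχ : χ.IsPrimitive) (hD : 2 ≤ D) {A B : ℕ} (hA : 1 ≤ A)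
    (hAB : A ≤ B) {x X₁ X₂ : ℝ} (κ : ℝ) (hx : 0 < x) (hX₁ : 0 < X₁) (hX₂ : 0 ≤ X₂) {g : ℝ → ℝ}
    (hg : Monotone g) (hg0 : ∀ y, 0 ≤ g y) (hg1 : ∀ y, g y ≤ 1) {θ s : ℂ} (hθ : θ.re = 0)
    (hs : s.re = 1) :
    ‖∑ m ∈ Ioc A B, conj (χ (m : ZMod D)) *
        (((x * m / X₁ : ℝ) : ℂ) ^ θ *
          ((κ : ℂ) * (((g (X₂ / (x * m)) : ℝ) : ℂ) - if x * (m : ℝ) < X₂ then 1 else 0)) /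
            (m : ℂ) ^ s)‖ ≤
      Real.sqrt D * (1 + Real.log D) *
        (|κ| * (3 + (‖s‖ + ‖θ‖) * ((B : ℝ) - A) / A) / A) := by
  have hA0 : (0 : ℝ) < A := by exact_mod_cast hA
  -- the two factors
  have hPn : ∀ m : ℕ, 1 ≤ m → ‖((x * m / X₁ : ℝ) : ℂ) ^ θ‖ = 1 := by
    intro m hm
    have hm0 : (0 : ℝ) < m := by exact_mod_cast hm
    rw [Complex.norm_cpow_eq_rpow_re_of_pos (div_pos (mul_pos hx hm0) hX₁), hθ, Real.rpow_zero]
  have hQn : ∀ m : ℕ,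
      ‖(κ : ℂ) * (((g (X₂ / (x * m)) : ℝ) : ℂ) - if x * (m : ℝ) < X₂ then 1 else 0)‖ ≤ |κ| := by
    intro m
    rw [norm_mul, Complex.norm_real, Real.norm_eq_abs]
    refine mul_le_of_le_one_right (abs_nonneg κ) ?_
    have h0 := hg0 (X₂ / (x * m))
    have h1 := hg1 (X₂ / (x * m))
    split_ifs with h
    · rw [← Complex.ofReal_one, ← Complex.ofReal_sub, Complex.norm_real, Real.norm_eq_abs, abs_le]
      constructor <;> linarith
    · rw [sub_zero, Complex.norm_real, Real.norm_eq_abs, abs_le]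
      constructor <;> linarith
  -- TV of the power factor
  have hTP : ∑ m ∈ Ioo A B,
      ‖((x * m / X₁ : ℝ) : ℂ) ^ θ - ((x * (m + 1 : ℕ) / X₁ : ℝ) : ℂ) ^ θ‖ ≤
        ‖θ‖ * ((B : ℝ) - A) / A := by
    rcases Nat.eq_or_lt_of_le hAB with rfl | hlt
    · simp
    rw [Ioo_eq_Ico_succ]
    have hresc : ∀ m : ℕ, ((x * m / X₁ : ℝ) : ℂ) = (((x / X₁) * m : ℝ) : ℂ) := by
      intro m; push_cast; ring
    simp_rw [hresc]
    have key := tv_ofReal_mul_natCast_cpow_le (div_pos hx hX₁) (a := A + 1) (b := B) (by omega)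
      (by omega) (w := θ) (by rw [hθ]; norm_num)
    refine key.trans ?_
    rw [hθ, Real.rpow_zero, one_mul, zero_sub]
    have hltR : (A : ℝ) < B := by exact_mod_cast hlt
    have h1 : ((A + 1 : ℕ) : ℝ) ^ (-1 : ℝ) ≤ 1 / (A : ℝ) := by
      rw [Real.rpow_neg_one, one_div]
      exact inv_anti₀ hA0 (by push_cast; linarith)
    calc ‖θ‖ * ((B : ℝ) - ((A + 1 : ℕ) : ℝ)) * ((A + 1 : ℕ) : ℝ) ^ (-1 : ℝ)
        ≤ ‖θ‖ * ((B : ℝ) - A) * (1 / (A : ℝ)) := by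
          apply mul_le_mul _ h1 (Real.rpow_nonneg (by positivity) _) (by
            apply mul_nonneg (norm_nonneg _); linarith)
          apply mul_le_mul_of_nonneg_left _ (norm_nonneg _)
          push_cast; linarith
      _ = ‖θ‖ * ((B : ℝ) - A) / A := by ring
  -- TV of the profile factor
  have hTQ : ∑ m ∈ Ioo A B,
      ‖(κ : ℂ) * (((g (X₂ / (x * m)) : ℝ) : ℂ) - (if x * (m : ℝ) < X₂ then 1 else 0)) -
        (κ : ℂ) * (((g (X₂ / (x * (m + 1 : ℕ))) : ℝ) : ℂ) -
          (if x * ((m + 1 : ℕ) : ℝ) < X₂ then 1 else 0))‖ ≤ 2 * |κ| := by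
    rw [tv_const_mul, Complex.norm_real, Real.norm_eq_abs]
    have hG : ∑ m ∈ Ioo A B,
        ‖(((g (X₂ / (x * m))) : ℝ) : ℂ) - (((g (X₂ / (x * (m + 1 : ℕ)))) : ℝ) : ℂ)‖ ≤ 1 := by
      rw [tv_ofReal (g := fun m : ℕ => g (X₂ / (x * m))), Ioo_eq_Ico_succ]
      rcases Nat.eq_or_lt_of_le hAB with rfl | hlt
      · rw [Finset.Ico_eq_empty (by omega), Finset.sum_empty]; norm_num
      exact (tv_comp_div_le hg hg0 hg1 hX₂ hx (a := A + 1) (b := B) (by omega) (by omega)).trans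
        (by norm_num)
    have hI : ∑ m ∈ Ioo A B,
        ‖(if x * (m : ℝ) < X₂ then (1 : ℂ) else 0) -
          (if x * ((m + 1 : ℕ) : ℝ) < X₂ then (1 : ℂ) else 0)‖ ≤ 1 :=
      (tv_step_le (p := fun m : ℕ => x * (m : ℝ) < X₂) (downward_mul_lt hx.le X₂) 1 0
        (Ioo A B)).trans (by simp)
    have hsub := tv_sub_le (fun m : ℕ => (((g (X₂ / (x * m))) : ℝ) : ℂ))
      (fun m : ℕ => if x * (m : ℝ) < X₂ then (1 : ℂ) else 0) (Ioo A B)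
    calc |κ| * ∑ m ∈ Ioo A B,
          ‖((((g (X₂ / (x * m))) : ℝ) : ℂ) - if x * (m : ℝ) < X₂ then 1 else 0) -
            ((((g (X₂ / (x * (m + 1 : ℕ)))) : ℝ) : ℂ) -
              if x * ((m + 1 : ℕ) : ℝ) < X₂ then 1 else 0)‖
        ≤ |κ| * (1 + 1) := by
          refine mul_le_mul_of_nonneg_left (hsub.trans (add_le_add hG hI)) (abs_nonneg κ)
      _ = 2 * |κ| := by ring
  have key := norm_window_sum_mul_le_far χ hχ hD hA hAB (abs_nonneg κ)
    (P := fun m : ℕ => ((x * m / X₁ : ℝ) : ℂ) ^ θ)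
    (Q := fun m : ℕ => (κ : ℂ) * (((g (X₂ / (x * m)) : ℝ) : ℂ) - if x * (m : ℝ) < X₂ then 1 else 0))
    (fun m hm => (hPn m (le_trans hA (Finset.mem_Ioc.mp hm).1.le)).le) (fun m _ => hQn m)
    hTP hTQ hs
  refine key.trans (le_of_eq ?_)
  have hA1 : (A : ℝ) ≠ 0 := hA0.ne'
  congr 1
  field_simp
  ring

end Far

end Literature.NumberTheory.LFunctions.Zhang2022.WindowAbelBV
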